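import Summits.CriticalPhenomena.PercolationContinuityZ3.Theorems.SahiMasterFamilyFInequalityBoundedConvexity
import Summits.CriticalPhenomena.PercolationContinuityZ3.Theorems.SahiMasterFamilyFInequalityComparable

/-!
# The `F`-inequality: the conditional-covariance form, three CERTIFIED FLOORS, and the floor-chord step

Unit `prim-master-conj` (crux anchor stmt-CriticalPhenomena-4575, helper work), gen 23; memo
`run/shared/lean/prim/prim-l12/prim-master-conj/POINTWISE.md` §24.  `F(A,B;G) := (1 + μG)·μ(A∩B∩G) − μG·μ(A∩B) − μ(A∩G)·μ(B∩G)`.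

* `fIneq_eq_cov_add_condCov` — **`F = Cov(A∩B, G) + [μG·μ(ABG) − μ(AG)·μ(BG)] = Cov(A∩B,G) + μ(G)²·Cov(A,B | G)`** (`ring`): the conjecture
  `F ≥ 0` says exactly that increasing events may be negatively correlated GIVEN an increasing event `G`, but by at most `Cov(A∩B,G)/μ(G)²`;
  `fIneq_nonneg_of_condHarris`: `F ≥ 0` whenever `μ(AG)μ(BG) ≤ μG·μ(ABG)` (conditional Harris holds).
* Three identities, each exhibiting `F` as an explicit quantity PLUS ONE nonnegative product of two Venn cells:
  `fIneq_eq_cov_add_cell_sub_cell`:  `F = Cov(AB,G) + μ(ABG)·μ(G∖(A∪B)) − μ(AG∖B)·μ(BG∖A)`;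
  `fIneq_eq_covFirst_add_cell_sub_cell`: `F = Cov(A, B∩G) + μ(A∖(B∪G))·μ(BG) − μ(AB∖G)·μ(G∖B)` (and the `A ↔ B` mirror by symmetry).
  Dropping the nonnegative product gives the CERTIFIED FLOORS `F ≥ Φ₁ := Cov(AB,G) − μ(AG∖B)μ(BG∖A)` (`fIneq_ge_floor_inter`) and
  `F ≥ Φ_A := Cov(A,BG) − μ(AB∖G)μ(G∖B)` (`fIneq_ge_floor_first`).
* NEW KERNEL CLASS `fIneq_nonneg_of_first_inter_third_subset_second`: **`A ∩ G ⊆ B ⟹ F(A,B;G) ≥ 0`** for increasing `A, B, G` (then `AG∖B = ∅`,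
  so `F ≥ Cov(A∩B, G) ≥ 0` by Harris); mirror `…_of_second_inter_third_subset_first`.  (Not a comparable-pair case: e.g. `A = x₁∨x₂`, `G = x₃∨x₁x₄`,
  `B = x₁x₃∨x₁x₄∨x₂x₃∨x₅`.)
* `fIneq_ge_floorChord` — the FLOOR-CHORD STEP: from the exact chord form `F = (1−t)F⁰ + tF¹ + t(1−t)D_e` (gen 22), if `F(T⁰), F(T¹) ≥ 0` (induction) and
  `φ_b ≤ F(T^b)` are any certified floors, then `F ≥ (1−t)·max(0,φ₀) + t·max(0,φ₁) + t(1−t)·D_e`.  With `φ = Φ* := max(Φ₁, Φ_A, Φ_B)` on the sections this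
  is the criterion KEY*_e; CENSUS (gen 23, exact floats, code prim-master-conj/code-g23/c/keycensus2.c): KEY*_e ≥ 0 for EVERY coordinate of EVERY triple
  on ≤ 4 coordinates at 10 parameter vectors (23.8·10⁶ triple–parameter pairs, worst −7·10⁻¹⁷), it FAILS at some coordinates from 5 coordinates on
  (e.g. `A = x₂, B = x₃, G = x₁ ∨ x₄(x₀∨x₂∨x₃)`, `p = (.2,.98,.941,.369,.824)`, `e = 1`), and no triple without a KEY*-good coordinate was found
  (adversarial search, ≤ 7 coordinates).  The floors are EXACT when `μ(A∖(B∪G)) = 0`, so KEY* is `F > 0` at every coordinate of the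
  `(Tribes, Tribes, Maj)` family that kills the plain good-coordinate criterion (gen 22).
HONEST FRAMING: identities, two small unconditional classes and a conditional step; `F ≥ 0` in general remains OPEN. [this work]
-/

noncomputable section

open scoped Classical

namespace Summit.CriticalPhenomena.PercolationContinuityZ3.Theorems

open Finset Function
open Literature.Combinatorics.Sahi2008
open Literature.Probability.Percolation.DecisionTree (ind)

namespace Pointwise

variable {ι : Type} [Fintype ι]

local notation3 (prettyPrint := false) "μ⟦" p ", " X "⟧" => ex (bernoulliWeight p) (ind X)

/-! ### 0. Venn-cell bookkeeping -/

/-- `μ(X ∩ Yᶜ) = μX − μ(X∩Y)`. [folklore] -/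
private theorem mu_inter_compl (p : ι → unitInterval) (X Y : Set (Set ι)) :
    μ⟦p, X ∩ Yᶜ⟧ = μ⟦p, X⟧ - μ⟦p, X ∩ Y⟧ := by
  have h := ex_ind_sub_of_subset (bernoulliWeight p) (Set.inter_subset_left : X ∩ Y ⊆ X)
  have hs : X \ (X ∩ Y) = X ∩ Yᶜ := by
    ext ω; simp only [Set.mem_sdiff, Set.mem_inter_iff, Set.mem_compl_iff]; tauto
  rw [hs] at h
  linarith

/-! ### 1. The conditional-covariance form -/

/-- **`F = Cov(A∩B, G) + [μG·μ(A∩B∩G) − μ(A∩G)·μ(B∩G)]`**; the bracket is `μ(G)²·Cov(A,B | G)`. [this work] -/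
theorem fIneq_eq_cov_add_condCov (p : ι → unitInterval) (A B G : Set (Set ι)) :
    (1 + μ⟦p, G⟧) * μ⟦p, A ∩ B ∩ G⟧ - μ⟦p, G⟧ * μ⟦p, A ∩ B⟧ - μ⟦p, A ∩ G⟧ * μ⟦p, B ∩ G⟧
      = (μ⟦p, A ∩ B ∩ G⟧ - μ⟦p, A ∩ B⟧ * μ⟦p, G⟧)
        + (μ⟦p, G⟧ * μ⟦p, A ∩ B ∩ G⟧ - μ⟦p, A ∩ G⟧ * μ⟦p, B ∩ G⟧) := by
  ring

/-- **Conditional Harris ⟹ `F ≥ 0`**: if `μ(A∩G)·μ(B∩G) ≤ μG·μ(A∩B∩G)` (i.e. `Cov(A,B | G) ≥ 0`) then `F(A,B;G) ≥ 0` for increasing `A, B, G`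
(the remaining term is `Cov(A∩B, G) ≥ 0`, Harris). [this work] -/
theorem fIneq_nonneg_of_condHarris (p : ι → unitInterval) {A B G : Set (Set ι)} (hA : IsUpperSet A) (hB : IsUpperSet B)
    (hG : IsUpperSet G) (h : μ⟦p, A ∩ G⟧ * μ⟦p, B ∩ G⟧ ≤ μ⟦p, G⟧ * μ⟦p, A ∩ B ∩ G⟧) :
    0 ≤ (1 + μ⟦p, G⟧) * μ⟦p, A ∩ B ∩ G⟧ - μ⟦p, G⟧ * μ⟦p, A ∩ B⟧ - μ⟦p, A ∩ G⟧ * μ⟦p, B ∩ G⟧ := by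
  rw [fIneq_eq_cov_add_condCov]
  have hH := cov_ind_nonneg p (hA.inter hB) hG
  linarith

/-! ### 2. Two identities "explicit part + one nonnegative cell product", and the certified floors -/

/-- **`F = Cov(A∩B, G) + μ(A∩B∩G)·μ(G ∖ (A∪B)) − μ((A∩G)∖B)·μ((B∩G)∖A)`** (cells written as intersections with complements). [this work] -/
theorem fIneq_eq_cov_add_cell_sub_cell (p : ι → unitInterval) (A B G : Set (Set ι)) :
    (1 + μ⟦p, G⟧) * μ⟦p, A ∩ B ∩ G⟧ - μ⟦p, G⟧ * μ⟦p, A ∩ B⟧ - μ⟦p, A ∩ G⟧ * μ⟦p, B ∩ G⟧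
      = (μ⟦p, A ∩ B ∩ G⟧ - μ⟦p, A ∩ B⟧ * μ⟦p, G⟧)
        + μ⟦p, A ∩ B ∩ G⟧ * μ⟦p, G ∩ Aᶜ ∩ Bᶜ⟧ - μ⟦p, A ∩ G ∩ Bᶜ⟧ * μ⟦p, B ∩ G ∩ Aᶜ⟧ := by
  have h0 := ex_ind_inter_compl_compl (bernoulliWeight p) G A B
  have h1 := mu_inter_compl p (A ∩ G) B
  have h2 := mu_inter_compl p (B ∩ G) A
  have e1 : G ∩ A = A ∩ G := Set.inter_comm G A
  have e2 : G ∩ B = B ∩ G := Set.inter_comm G B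
  have e4 : A ∩ G ∩ B = A ∩ B ∩ G := by ext ω; simp only [Set.mem_inter_iff]; tauto
  have e5 : B ∩ G ∩ A = A ∩ B ∩ G := by ext ω; simp only [Set.mem_inter_iff]; tauto
  rw [e1, e2, e4] at h0
  rw [e4] at h1
  rw [e5] at h2
  rw [h0, h1, h2]
  ring

/-- **CERTIFIED FLOOR `Φ₁`**: `F(A,B;G) ≥ Cov(A∩B, G) − μ((A∩G)∖B)·μ((B∩G)∖A)` (drop the nonnegative product `μ(ABG)·μ(G∖(A∪B))`). [this work] -/
theorem fIneq_ge_floor_inter (p : ι → unitInterval) (A B G : Set (Set ι)) :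
    (μ⟦p, A ∩ B ∩ G⟧ - μ⟦p, A ∩ B⟧ * μ⟦p, G⟧) - μ⟦p, A ∩ G ∩ Bᶜ⟧ * μ⟦p, B ∩ G ∩ Aᶜ⟧
      ≤ (1 + μ⟦p, G⟧) * μ⟦p, A ∩ B ∩ G⟧ - μ⟦p, G⟧ * μ⟦p, A ∩ B⟧ - μ⟦p, A ∩ G⟧ * μ⟦p, B ∩ G⟧ := by
  rw [fIneq_eq_cov_add_cell_sub_cell]
  nlinarith [ex_ind_nonneg' p (A ∩ B ∩ G), ex_ind_nonneg' p (G ∩ Aᶜ ∩ Bᶜ)]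

/-- **NEW CLASS: `A ∩ G ⊆ B ⟹ F(A,B;G) ≥ 0`** for increasing `A, B, G` (then `(A∩G)∖B = ∅`, and `F ≥ Cov(A∩B, G) ≥ 0` by Harris). [this work] -/
theorem fIneq_nonneg_of_first_inter_third_subset_second (p : ι → unitInterval) {A B G : Set (Set ι)} (hA : IsUpperSet A)
    (hB : IsUpperSet B) (hG : IsUpperSet G) (h : A ∩ G ⊆ B) :
    0 ≤ (1 + μ⟦p, G⟧) * μ⟦p, A ∩ B ∩ G⟧ - μ⟦p, G⟧ * μ⟦p, A ∩ B⟧ - μ⟦p, A ∩ G⟧ * μ⟦p, B ∩ G⟧ := by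
  have hfl := fIneq_ge_floor_inter p A B G
  have hempty : A ∩ G ∩ Bᶜ = ∅ := by
    ext ω
    simp only [Set.mem_inter_iff, Set.mem_compl_iff, Set.mem_empty_iff_false, iff_false, not_and, not_not]
    exact fun hAG => h hAG
  rw [hempty, SahiCombDisjunct.ex_ind_empty, zero_mul, sub_zero] at hfl
  have hH := cov_ind_nonneg p (hA.inter hB) hG
  linarith

/-- Mirror: **`B ∩ G ⊆ A ⟹ F(A,B;G) ≥ 0`**. [this work] -/
theorem fIneq_nonneg_of_second_inter_third_subset_first (p : ι → unitInterval) {A B G : Set (Set ι)} (hA : IsUpperSet A)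
    (hB : IsUpperSet B) (hG : IsUpperSet G) (h : B ∩ G ⊆ A) :
    0 ≤ (1 + μ⟦p, G⟧) * μ⟦p, A ∩ B ∩ G⟧ - μ⟦p, G⟧ * μ⟦p, A ∩ B⟧ - μ⟦p, A ∩ G⟧ * μ⟦p, B ∩ G⟧ := by
  have h' := fIneq_nonneg_of_first_inter_third_subset_second p hB hA hG (G := G) h
  rw [Set.inter_comm B A] at h'
  linarith

/-- **`F = Cov(A, B∩G) + μ(A ∖ (B∪G))·μ(B∩G) − μ((A∩B)∖G)·μ(G∖B)`** — the charge decomposition of the first argument. [this work] -/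
theorem fIneq_eq_covFirst_add_cell_sub_cell (p : ι → unitInterval) (A B G : Set (Set ι)) :
    (1 + μ⟦p, G⟧) * μ⟦p, A ∩ B ∩ G⟧ - μ⟦p, G⟧ * μ⟦p, A ∩ B⟧ - μ⟦p, A ∩ G⟧ * μ⟦p, B ∩ G⟧
      = (μ⟦p, A ∩ (B ∩ G)⟧ - μ⟦p, A⟧ * μ⟦p, B ∩ G⟧)
        + μ⟦p, A ∩ Bᶜ ∩ Gᶜ⟧ * μ⟦p, B ∩ G⟧ - μ⟦p, A ∩ B ∩ Gᶜ⟧ * μ⟦p, G ∩ Bᶜ⟧ := by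
  have h0 := ex_ind_inter_compl_compl (bernoulliWeight p) A B G
  have h1 := mu_inter_compl p (A ∩ B) G
  have h2 := mu_inter_compl p G B
  have e1 : A ∩ (B ∩ G) = A ∩ B ∩ G := (Set.inter_assoc A B G).symm
  have e2 : G ∩ B = B ∩ G := Set.inter_comm G B
  rw [e2] at h2
  rw [h0, h1, h2, e1]
  ring

/-- **CERTIFIED FLOOR `Φ_A`**: `F(A,B;G) ≥ Cov(A, B∩G) − μ((A∩B)∖G)·μ(G∖B)`. [this work] -/
theorem fIneq_ge_floor_first (p : ι → unitInterval) (A B G : Set (Set ι)) :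
    (μ⟦p, A ∩ (B ∩ G)⟧ - μ⟦p, A⟧ * μ⟦p, B ∩ G⟧) - μ⟦p, A ∩ B ∩ Gᶜ⟧ * μ⟦p, G ∩ Bᶜ⟧
      ≤ (1 + μ⟦p, G⟧) * μ⟦p, A ∩ B ∩ G⟧ - μ⟦p, G⟧ * μ⟦p, A ∩ B⟧ - μ⟦p, A ∩ G⟧ * μ⟦p, B ∩ G⟧ := by
  rw [fIneq_eq_covFirst_add_cell_sub_cell]
  nlinarith [ex_ind_nonneg' p (A ∩ Bᶜ ∩ Gᶜ), ex_ind_nonneg' p (B ∩ G)]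

/-- **`μ((A∩B)∖G)·μ(G∖B) ≤ Cov(A, B∩G) ⟹ F(A,B;G) ≥ 0`** (the floor `Φ_A` is nonnegative); in particular this recovers `A ∩ B ⊆ G ⟹ F ≥ 0`
(prim-bnk-2) and `G ⊆ B ⟹ F ≥ 0` for increasing events, where the product vanishes. [this work] -/
theorem fIneq_nonneg_of_floor_first_nonneg (p : ι → unitInterval) {A B G : Set (Set ι)}
    (h : μ⟦p, A ∩ B ∩ Gᶜ⟧ * μ⟦p, G ∩ Bᶜ⟧ ≤ μ⟦p, A ∩ (B ∩ G)⟧ - μ⟦p, A⟧ * μ⟦p, B ∩ G⟧) :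
    0 ≤ (1 + μ⟦p, G⟧) * μ⟦p, A ∩ B ∩ G⟧ - μ⟦p, G⟧ * μ⟦p, A ∩ B⟧ - μ⟦p, A ∩ G⟧ * μ⟦p, B ∩ G⟧ := by
  have hfl := fIneq_ge_floor_first p A B G
  linarith

/-! ### 3. The floor-chord step -/

/-- **FLOOR-CHORD STEP.**  For any coordinate `e`: if the two section instances `F(A⁰,B⁰;G⁰), F(A¹,B¹;G¹)` are `≥ 0` (induction) and
`φ₀, φ₁` are any certified lower bounds for them, then
`F(A,B;G) ≥ (1−p_e)·max(0,φ₀) + p_e·max(0,φ₁) + p_e(1−p_e)·D_e`  (exact chord form `fIneq_eq_chord_add_dLoc`, gen 22).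
With the floors of §2 on the sections this is the criterion KEY*_e of the file header. [this work] -/
theorem fIneq_ge_floorChord (p : ι → unitInterval) (e : ι) (A B G : Set (Set ι)) (φ₀ φ₁ : ℝ)
    (hF0 : 0 ≤ (1 + μ⟦p, secAt e false G⟧) * μ⟦p, secAt e false A ∩ secAt e false B ∩ secAt e false G⟧
          - μ⟦p, secAt e false G⟧ * μ⟦p, secAt e false A ∩ secAt e false B⟧
          - μ⟦p, secAt e false A ∩ secAt e false G⟧ * μ⟦p, secAt e false B ∩ secAt e false G⟧)
    (hF1 : 0 ≤ (1 + μ⟦p, secAt e true G⟧) * μ⟦p, secAt e true A ∩ secAt e true B ∩ secAt e true G⟧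
          - μ⟦p, secAt e true G⟧ * μ⟦p, secAt e true A ∩ secAt e true B⟧
          - μ⟦p, secAt e true A ∩ secAt e true G⟧ * μ⟦p, secAt e true B ∩ secAt e true G⟧)
    (hφ0 : φ₀ ≤ (1 + μ⟦p, secAt e false G⟧) * μ⟦p, secAt e false A ∩ secAt e false B ∩ secAt e false G⟧
          - μ⟦p, secAt e false G⟧ * μ⟦p, secAt e false A ∩ secAt e false B⟧
          - μ⟦p, secAt e false A ∩ secAt e false G⟧ * μ⟦p, secAt e false B ∩ secAt e false G⟧)
    (hφ1 : φ₁ ≤ (1 + μ⟦p, secAt e true G⟧) * μ⟦p, secAt e true A ∩ secAt e true B ∩ secAt e true G⟧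
          - μ⟦p, secAt e true G⟧ * μ⟦p, secAt e true A ∩ secAt e true B⟧
          - μ⟦p, secAt e true A ∩ secAt e true G⟧ * μ⟦p, secAt e true B ∩ secAt e true G⟧) :
    (1 - (p e : ℝ)) * max 0 φ₀ + (p e : ℝ) * max 0 φ₁
        + (p e : ℝ) * (1 - (p e : ℝ)) *
          ((μ⟦p, secAt e true A ∩ secAt e true G⟧ - μ⟦p, secAt e false A ∩ secAt e false G⟧)
              * (μ⟦p, secAt e true B ∩ secAt e true G⟧ - μ⟦p, secAt e false B ∩ secAt e false G⟧)
            + (μ⟦p, secAt e true G⟧ - μ⟦p, secAt e false G⟧)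
              * ((μ⟦p, secAt e true A ∩ secAt e true B⟧ - μ⟦p, secAt e true A ∩ secAt e true B ∩ secAt e true G⟧)
                - (μ⟦p, secAt e false A ∩ secAt e false B⟧ - μ⟦p, secAt e false A ∩ secAt e false B ∩ secAt e false G⟧)))
      ≤ (1 + μ⟦p, G⟧) * μ⟦p, A ∩ B ∩ G⟧ - μ⟦p, G⟧ * μ⟦p, A ∩ B⟧ - μ⟦p, A ∩ G⟧ * μ⟦p, B ∩ G⟧ := by
  rw [fIneq_eq_chord_add_dLoc p e A B G]
  have ht0 : 0 ≤ (p e : ℝ) := (p e).2.1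
  have ht1 : 0 ≤ 1 - (p e : ℝ) := sub_nonneg.2 (p e).2.2
  have m0 : max 0 φ₀ ≤ (1 + μ⟦p, secAt e false G⟧) * μ⟦p, secAt e false A ∩ secAt e false B ∩ secAt e false G⟧
          - μ⟦p, secAt e false G⟧ * μ⟦p, secAt e false A ∩ secAt e false B⟧
          - μ⟦p, secAt e false A ∩ secAt e false G⟧ * μ⟦p, secAt e false B ∩ secAt e false G⟧ := max_le hF0 hφ0
  have m1 : max 0 φ₁ ≤ (1 + μ⟦p, secAt e true G⟧) * μ⟦p, secAt e true A ∩ secAt e true B ∩ secAt e true G⟧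
          - μ⟦p, secAt e true G⟧ * μ⟦p, secAt e true A ∩ secAt e true B⟧
          - μ⟦p, secAt e true A ∩ secAt e true G⟧ * μ⟦p, secAt e true B ∩ secAt e true G⟧ := max_le hF1 hφ1
  nlinarith [mul_le_mul_of_nonneg_left m0 ht1, mul_le_mul_of_nonneg_left m1 ht0]

/-- **`F ≥ 0` from the floor-chord criterion at one coordinate**: if the sections satisfy `F ≥ 0`, `φ_b` are certified floors, and
`(1−p_e)·max(0,φ₀) + p_e·max(0,φ₁) + p_e(1−p_e)·D_e ≥ 0` (KEY*_e), then `F(A,B;G) ≥ 0`. [this work] -/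
theorem fIneq_nonneg_of_floorChord (p : ι → unitInterval) (e : ι) (A B G : Set (Set ι)) (φ₀ φ₁ : ℝ)
    (hF0 : 0 ≤ (1 + μ⟦p, secAt e false G⟧) * μ⟦p, secAt e false A ∩ secAt e false B ∩ secAt e false G⟧
          - μ⟦p, secAt e false G⟧ * μ⟦p, secAt e false A ∩ secAt e false B⟧
          - μ⟦p, secAt e false A ∩ secAt e false G⟧ * μ⟦p, secAt e false B ∩ secAt e false G⟧)
    (hF1 : 0 ≤ (1 + μ⟦p, secAt e true G⟧) * μ⟦p, secAt e true A ∩ secAt e true B ∩ secAt e true G⟧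
          - μ⟦p, secAt e true G⟧ * μ⟦p, secAt e true A ∩ secAt e true B⟧
          - μ⟦p, secAt e true A ∩ secAt e true G⟧ * μ⟦p, secAt e true B ∩ secAt e true G⟧)
    (hφ0 : φ₀ ≤ (1 + μ⟦p, secAt e false G⟧) * μ⟦p, secAt e false A ∩ secAt e false B ∩ secAt e false G⟧
          - μ⟦p, secAt e false G⟧ * μ⟦p, secAt e false A ∩ secAt e false B⟧
          - μ⟦p, secAt e false A ∩ secAt e false G⟧ * μ⟦p, secAt e false B ∩ secAt e false G⟧)
    (hφ1 : φ₁ ≤ (1 + μ⟦p, secAt e true G⟧) * μ⟦p, secAt e true A ∩ secAt e true B ∩ secAt e true G⟧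
          - μ⟦p, secAt e true G⟧ * μ⟦p, secAt e true A ∩ secAt e true B⟧
          - μ⟦p, secAt e true A ∩ secAt e true G⟧ * μ⟦p, secAt e true B ∩ secAt e true G⟧)
    (hKEY : 0 ≤ (1 - (p e : ℝ)) * max 0 φ₀ + (p e : ℝ) * max 0 φ₁
        + (p e : ℝ) * (1 - (p e : ℝ)) *
          ((μ⟦p, secAt e true A ∩ secAt e true G⟧ - μ⟦p, secAt e false A ∩ secAt e false G⟧)
              * (μ⟦p, secAt e true B ∩ secAt e true G⟧ - μ⟦p, secAt e false B ∩ secAt e false G⟧)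
            + (μ⟦p, secAt e true G⟧ - μ⟦p, secAt e false G⟧)
              * ((μ⟦p, secAt e true A ∩ secAt e true B⟧ - μ⟦p, secAt e true A ∩ secAt e true B ∩ secAt e true G⟧)
                - (μ⟦p, secAt e false A ∩ secAt e false B⟧ - μ⟦p, secAt e false A ∩ secAt e false B ∩ secAt e false G⟧)))) :
    0 ≤ (1 + μ⟦p, G⟧) * μ⟦p, A ∩ B ∩ G⟧ - μ⟦p, G⟧ * μ⟦p, A ∩ B⟧ - μ⟦p, A ∩ G⟧ * μ⟦p, B ∩ G⟧ :=
  le_trans hKEY (fIneq_ge_floorChord p e A B G φ₀ φ₁ hF0 hF1 hφ0 hφ1)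

end Pointwise

end Summit.CriticalPhenomena.PercolationContinuityZ3.Theorems
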